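import Literature.NumberTheory.DiophantineGeometry.GenEllCuspTransfer
import Mathlib.RingTheory.Polynomial.Chebyshev
import HarnessLib

/-!
# [GenEll] Thm. 2.1, proof: the transfer along the Chebyshev (Dickson) maps `x ↦ (C_p(4x − 2) + 2)/4`

S. Mochizuki, *Arithmetic elliptic curves in general position*, Math. J. Okayama Univ. 52 (2010)
[cite: MochizukiGenEll2010, Thm 2.1 pp.11–13]. The third family of cusp-preserving Belyi maps of the
menu of the cell's ℙ¹-route for GenEllTwo: the Dickson/Chebyshev polynomials `C_p` (Mathlib
`Polynomial.Chebyshev.C`, `C_p(u + u⁻¹) = u^p + u^{−p}`), `p = 2m + 1` odd, map `{−2, 2, ∞}` into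
itself (`C_p(±2) = ±2`) and are unramified outside `C_p⁻¹{±2, ∞}`; conjugating by the affine chart
`x ↦ 4x − 2` (`0, 1, ∞ ↦ −2, 2, ∞`) gives `γ_p(x) := (C_p(4x − 2) + 2)/4 : ℙ¹ → ℙ¹` with
`γ_p({0,1,∞}) ⊆ {0,1,∞}` and `|γ_p⁻¹{0,1,∞}| = p + 2`. The algebraic heart is the pair of FACTORISATIONS
(proved here from Mathlib's recurrences and `S_sq_add_S_sq`, private):
`C_{2m+1} − 2 = (X − 2)·(S_m + S_{m−1})²`, `C_{2m+1} + 2 = (X + 2)·(S_m − S_{m−1})²`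
(`S_n` = Mathlib's `Chebyshev.S`, `S_n(u + u⁻¹) = (u^{n+1} − u^{−n−1})/(u − u⁻¹)`), whence
`num = C_p(4t−2) + 2 = 4t·V²`, `num − den = C_p(4t−2) − 2 = 4(t−1)·W²` and the reduced-pullback
certificate with `B = V·W` (degree `2m = p − 1`), `k = p`, `c = 64`,
`h = t^{2m}(t−1)^{2m}(VW)^{2m−1}` (`P1FiniteMap.chebReduced`). The transfer
(`vojtaIneq_transfer_cheb`): Vojta with `ε` on `T` ⟹ Vojta with `(1+ε)/(1 − 2mε) − 1` on the points whose
`γ_p`-image lies in `T`, GIVEN the height lower bound `p·ht(x) ≤ ht(γ_p(x)) + O(1)` for this degree-`p`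
polynomial map (hypothesis `hlow`; it is the weighted root-height bound for the monic relation
`C_p(4x−2) + 2 − 4·γ_p(x) = 0` of degree `p` in `x`, the cell's W4a lemma, consumed by name when it lands).
Classical; abc-iut cell, route item GenEllTwo (stmt-ABC-19679), work package W2; nothing here bears on
[IUTchIII] Cor. 3.12.
-/

noncomputable section

open NumberField Height Polynomial Polynomial.Chebyshev Finset

namespace Literature.NumberTheory.DiophantineGeometry.GenEll

/-! ## Dickson factorisations (private algebra over a commutative ring) -/

section Dickson

variable (R : Type*) [CommRing R]

/-- Joint identities `(X²−4)·S_m² = C_{2m+2} − 2` and `(X²−4)·S_{m−1}·S_m = C_{2m+1} − X` (in the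
`u + u⁻¹` model: `(u − u⁻¹)²·S_m² = (u^{m+1} − u^{−m−1})²`, etc.). [folklore] -/
private theorem dickson_aux (m : ℕ) :
    (X ^ 2 - 4 : R[X]) * S R m ^ 2 = Chebyshev.C R (2 * m + 2) - 2 ∧
      (X ^ 2 - 4 : R[X]) * S R ((m : ℤ) - 1) * S R m = Chebyshev.C R (2 * m + 1) - X := by
  induction m with
  | zero =>
    refine ⟨?_, ?_⟩
    · simp only [Nat.cast_zero, S_zero, mul_zero, zero_add, C_two]; ring
    · simp only [Nat.cast_zero, zero_sub, S_neg_one, mul_zero, zero_mul, zero_add, C_one, sub_self]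
  | succ m ih =>
    obtain ⟨hA, hB⟩ := ih
    have hS : S R ((m : ℤ) + 1) = X * S R m - S R ((m : ℤ) - 1) := S_add_one R m
    have hC3 : Chebyshev.C R (2 * (m : ℤ) + 3) =
        X * Chebyshev.C R (2 * m + 2) - Chebyshev.C R (2 * m + 1) := by
      have := C_add_one R (2 * m + 2)
      rw [show (2 * (m : ℤ) + 2 + 1) = 2 * m + 3 by ring,
        show (2 * (m : ℤ) + 2 - 1) = 2 * m + 1 by ring] at this
      exact this
    have hC4 : Chebyshev.C R (2 * (m : ℤ) + 4) =
        X * Chebyshev.C R (2 * m + 3) - Chebyshev.C R (2 * m + 2) := by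
      have := C_add_one R (2 * m + 3)
      rw [show (2 * (m : ℤ) + 3 + 1) = 2 * m + 4 by ring,
        show (2 * (m : ℤ) + 3 - 1) = 2 * m + 2 by ring] at this
      exact this
    have hSq : S R m ^ 2 + S R ((m : ℤ) + 1) ^ 2 - X * S R m * S R ((m : ℤ) + 1) = 1 :=
      S_sq_add_S_sq R m
    have hB' : (X ^ 2 - 4 : R[X]) * S R m * S R ((m : ℤ) + 1) = Chebyshev.C R (2 * m + 3) - X := by
      rw [hS, hC3]
      linear_combination X * hA - hB
    push_cast
    refine ⟨?_, ?_⟩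
    · rw [show (2 * ((m : ℤ) + 1) + 2) = 2 * m + 4 by ring, hC4, hC3]
      linear_combination (X ^ 2 - 4 : R[X]) * hSq - hA + X * hB' + X * hC3
    · rw [show ((m : ℤ) + 1 - 1) = m by ring, show (2 * ((m : ℤ) + 1) + 1) = 2 * m + 3 by ring]
      exact hB'

/-- `C_{2m+1} − 2 = (X − 2)·(S_m + S_{m−1})²`. [folklore] -/
private theorem C_odd_sub_two (m : ℕ) :
    Chebyshev.C R (2 * m + 1) - 2 = (X - 2 : R[X]) * (S R m + S R ((m : ℤ) - 1)) ^ 2 := by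
  have hB := (dickson_aux R m).2
  have hSq : S R ((m : ℤ) - 1) ^ 2 + S R m ^ 2 - X * S R ((m : ℤ) - 1) * S R m = 1 := by
    have := S_sq_add_S_sq R ((m : ℤ) - 1)
    rwa [show ((m : ℤ) - 1 + 1) = m by ring] at this
  linear_combination -hB - (X - 2 : R[X]) * hSq

/-- `C_{2m+1} + 2 = (X + 2)·(S_m − S_{m−1})²`. [folklore] -/
private theorem C_odd_add_two (m : ℕ) :
    Chebyshev.C R (2 * m + 1) + 2 = (X + 2 : R[X]) * (S R m - S R ((m : ℤ) - 1)) ^ 2 := by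
  have hB := (dickson_aux R m).2
  have hSq : S R ((m : ℤ) - 1) ^ 2 + S R m ^ 2 - X * S R ((m : ℤ) - 1) * S R m = 1 := by
    have := S_sq_add_S_sq R ((m : ℤ) - 1)
    rwa [show ((m : ℤ) - 1 + 1) = m by ring] at this
  linear_combination -hB - (X + 2 : R[X]) * hSq

/-- `deg S_n ≤ n` and `deg S_{n+1} ≤ n + 1`. [folklore] -/
private theorem natDegree_S_le_aux (n : ℕ) :
    (S R n).natDegree ≤ n ∧ (S R ((n : ℤ) + 1)).natDegree ≤ n + 1 := by
  induction n with
  | zero =>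
    refine ⟨by simp, ?_⟩
    simp only [Nat.cast_zero, zero_add, S_one]
    exact natDegree_X_le
  | succ n ih =>
    obtain ⟨h0, h1⟩ := ih
    push_cast
    refine ⟨h1, ?_⟩
    have hrec : S R ((n : ℤ) + 1 + 1) = X * S R ((n : ℤ) + 1) - S R n := by
      have := S_add_one R ((n : ℤ) + 1)
      rwa [show ((n : ℤ) + 1 - 1) = n by ring] at this
    rw [hrec]
    refine (natDegree_sub_le _ _).trans (max_le ?_ (h0.trans (by omega)))
    exact natDegree_mul_le.trans (by rw [add_comm]; exact Nat.add_le_add h1 natDegree_X_le)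

/-- `deg S_n ≤ n`. [folklore] -/
private theorem natDegree_S_le (n : ℕ) : (S R n).natDegree ≤ n := (natDegree_S_le_aux R n).1

/-- `deg (S_m ± S_{m−1}) ≤ m`. [folklore] -/
private theorem natDegree_S_add_sub_le (m : ℕ) :
    (S R m + S R ((m : ℤ) - 1)).natDegree ≤ m ∧ (S R m - S R ((m : ℤ) - 1)).natDegree ≤ m := by
  have h1 : (S R ((m : ℤ) - 1)).natDegree ≤ m := by
    rcases Nat.eq_zero_or_pos m with rfl | hm
    · simp
    · obtain ⟨k, rfl⟩ : ∃ k, m = k + 1 := ⟨m - 1, by omega⟩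
      push_cast
      rw [show ((k : ℤ) + 1 - 1) = k by ring]
      exact (natDegree_S_le R k).trans (by omega)
  exact ⟨(natDegree_add_le _ _).trans (max_le (natDegree_S_le R m) h1),
    (natDegree_sub_le _ _).trans (max_le (natDegree_S_le R m) h1)⟩

/-- `S_n` is monic of degree exactly `n` (`S_0 = 1`, `S_1 = X`, `S_{n+2} = X S_{n+1} − S_n`). [folklore] -/
private theorem monic_S_natDegree (R : Type*) [CommRing R] [Nontrivial R] (n : ℕ) :
    ((S R n).Monic ∧ (S R n).natDegree = n) ∧
      ((S R ((n : ℤ) + 1)).Monic ∧ (S R ((n : ℤ) + 1)).natDegree = n + 1) := by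
  induction n with
  | zero =>
    refine ⟨⟨by simp [S_zero], by simp [S_zero]⟩, ?_, ?_⟩
    · simp only [Nat.cast_zero, zero_add, S_one]; exact monic_X
    · simp only [Nat.cast_zero, zero_add, S_one]; exact natDegree_X
  | succ n ih =>
    obtain ⟨⟨hm0, hd0⟩, hm1, hd1⟩ := ih
    push_cast
    refine ⟨⟨hm1, hd1⟩, ?_⟩
    have hrec : S R ((n : ℤ) + 1 + 1) = X * S R ((n : ℤ) + 1) - S R n := by
      have := S_add_one R ((n : ℤ) + 1)
      rwa [show ((n : ℤ) + 1 - 1) = n by ring] at this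
    have hXS : (X * S R ((n : ℤ) + 1)).Monic := monic_X.mul hm1
    have hdXS : (X * S R ((n : ℤ) + 1)).natDegree = n + 2 := by
      rw [(monic_X (R := R)).natDegree_mul hm1, natDegree_X, hd1]; ring
    have hlt : (S R n).natDegree < (X * S R ((n : ℤ) + 1)).natDegree := by rw [hdXS, hd0]; omega
    rw [hrec]
    exact ⟨hXS.sub_of_left (by rw [degree_eq_natDegree hXS.ne_zero]; exact
      (degree_le_natDegree).trans_lt (by exact_mod_cast hlt)),
      by rw [natDegree_sub_eq_left_of_natDegree_lt hlt, hdXS]⟩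

/-- `deg (S_m − S_{m−1}) = m` and its leading coefficient is `1`. [folklore] -/
private theorem natDegree_S_sub (R : Type*) [CommRing R] [Nontrivial R] (m : ℕ) :
    (S R m - S R ((m : ℤ) - 1)).natDegree = m ∧ (S R m - S R ((m : ℤ) - 1)).Monic := by
  rcases Nat.eq_zero_or_pos m with rfl | hm
  · simp
  · obtain ⟨k, rfl⟩ : ∃ k, m = k + 1 := ⟨m - 1, by omega⟩
    obtain ⟨⟨hm0, hd0⟩, hm1, hd1⟩ := monic_S_natDegree R k
    push_cast
    rw [show ((k : ℤ) + 1 - 1) = k by ring]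
    have hlt : (S R k).natDegree < (S R ((k : ℤ) + 1)).natDegree := by rw [hd0, hd1]; omega
    exact ⟨by rw [natDegree_sub_eq_left_of_natDegree_lt hlt, hd1],
      hm1.sub_of_left (by rw [degree_eq_natDegree hm1.ne_zero]; exact
        (degree_le_natDegree).trans_lt (by exact_mod_cast hlt))⟩

end Dickson

/-! ## The Chebyshev family as cusp-preserving maps of `(ℙ¹, {0,1,∞})` -/

namespace P1FiniteMap

/-- The chart `t ↦ 4t − 2` (`0, 1 ↦ −2, 2`). [folklore] -/
private def chart : ℤ[X] := 4 * X - 2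

/-- `deg (4t − 2) ≤ 1`. [folklore] -/
private theorem natDegree_chart_le : (chart).natDegree ≤ 1 :=
  (natDegree_sub_le _ _).trans (max_le (natDegree_mul_le.trans (by
    rw [show (4 : ℤ[X]) = Polynomial.C 4 by rfl, natDegree_C, zero_add]; exact natDegree_X_le))
    (by rw [show (2 : ℤ[X]) = Polynomial.C 2 by rfl, natDegree_C]; exact Nat.zero_le _))

/-- `V_m(4t−2)`, `V_m = S_m − S_{m−1}` (so that `C_{2m+1}(4t−2) + 2 = 4t·V_m(4t−2)²`). [folklore] -/
private def chebV (m : ℕ) : ℤ[X] := (S ℤ m - S ℤ ((m : ℤ) - 1)).comp chart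

/-- `W_m(4t−2)`, `W_m = S_m + S_{m−1}` (so that `C_{2m+1}(4t−2) − 2 = 4(t−1)·W_m(4t−2)²`). [folklore] -/
private def chebW (m : ℕ) : ℤ[X] := (S ℤ m + S ℤ ((m : ℤ) - 1)).comp chart

/-- `deg V_m(4t−2) ≤ m`. [folklore] -/
private theorem natDegree_chebV_le (m : ℕ) : (chebV m).natDegree ≤ m :=
  natDegree_comp_le.trans (by
    calc _ ≤ m * 1 := Nat.mul_le_mul (natDegree_S_add_sub_le ℤ m).2 natDegree_chart_le
      _ = m := mul_one m)

/-- `deg W_m(4t−2) ≤ m`. [folklore] -/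
private theorem natDegree_chebW_le (m : ℕ) : (chebW m).natDegree ≤ m :=
  natDegree_comp_le.trans (by
    calc _ ≤ m * 1 := Nat.mul_le_mul (natDegree_S_add_sub_le ℤ m).1 natDegree_chart_le
      _ = m := mul_one m)

/-- `C_{2m+1}(4t−2) + 2 = 4t · V²`. [folklore] -/
private theorem cheb_num_eq (m : ℕ) :
    (Chebyshev.C ℤ (2 * m + 1)).comp chart + 2 = 4 * X * chebV m ^ 2 := by
  have h := congrArg (fun p : ℤ[X] => p.comp chart) (C_odd_add_two ℤ m)
  simp only [add_comp, mul_comp, pow_comp, X_comp, ofNat_comp, Nat.cast_ofNat] at h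
  rw [h, chebV]
  simp only [chart]
  ring

/-- `C_{2m+1}(4t−2) − 2 = 4(t−1) · W²`. [folklore] -/
private theorem cheb_num_sub_den_eq (m : ℕ) :
    (Chebyshev.C ℤ (2 * m + 1)).comp chart + 2 - 4 = 4 * (X - 1) * chebW m ^ 2 := by
  have h := congrArg (fun p : ℤ[X] => p.comp chart) (C_odd_sub_two ℤ m)
  simp only [sub_comp, mul_comp, pow_comp, X_comp, ofNat_comp, Nat.cast_ofNat] at h
  rw [show (Chebyshev.C ℤ (2 * m + 1)).comp chart + 2 - 4 = (Chebyshev.C ℤ (2 * m + 1)).comp chart - 2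
    by ring, h, chebW]
  simp only [chart]
  ring

/-- The Chebyshev map `γ_p = (C_p(4t−2) + 2 : 4) : ℙ¹ → ℙ¹`, `p = 2m+1`, `x ↦ (C_p(4x−2)+2)/4`: the
Dickson polynomial of odd degree in the chart sending `0, 1, ∞` to `−2, 2, ∞`; a cusp-preserving Belyi
map of degree `p`. [cite: MochizukiGenEll2010, Thm 2.1 p.13] -/
def cheb (m : ℕ) : P1FiniteMap where
  num := (Chebyshev.C ℤ (2 * m + 1)).comp (4 * X - 2) + 2
  den := 4
  deg := 2 * m + 1
  natDegree_num_le := by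
    change ((Chebyshev.C ℤ (2 * m + 1)).comp chart + 2).natDegree ≤ 2 * m + 1
    rw [cheb_num_eq]
    refine natDegree_mul_le.trans ?_
    have h4X : (4 * X : ℤ[X]).natDegree ≤ 1 := natDegree_mul_le.trans (by
      rw [show (4 : ℤ[X]) = Polynomial.C 4 by rfl, natDegree_C, zero_add]; exact natDegree_X_le)
    have hV2 : (chebV m ^ 2).natDegree ≤ 2 * m :=
      natDegree_pow_le.trans (by linarith [natDegree_chebV_le m])
    omega
  natDegree_den_le := by
    rw [show (4 : ℤ[X]) = Polynomial.C 4 by rfl, natDegree_C]; exact Nat.zero_le _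

/-- `γ_p(x) = (C_p(4x − 2) + 2)/4` (Mathlib's `Chebyshev.C` over the field of `x`).
[cite: MochizukiGenEll2010, Thm 2.1 p.13] -/
theorem eval_cheb (m : ℕ) {F : Type*} [Field F] [CharZero F] (x : F) :
    (cheb m).eval x = ((Chebyshev.C F (2 * m + 1)).eval (4 * x - 2) + 2) / 4 := by
  simp only [eval, cheb, map_add, aeval_comp, Chebyshev.aeval_C, map_sub, map_mul, aeval_X, map_ofNat]

/-- THE REDUCED-PULLBACK CERTIFICATE of `γ_p`, `p = 2m + 1 ≥ 3`: `γ_p⁻¹(C)_red = C + B`,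
`B = V(V_m(4t−2)·W_m(4t−2))` of degree `2m = p − 1`; identity
`f·4·(f − 4)·t^{2m}(t−1)^{2m}(VW)^{2m−1} = 64·((t²−t)·VW)^p` with `f = 4t V²`, `f − 4 = 4(t−1) W²`.
[cite: MochizukiGenEll2010, Prop 1.7 p.9] -/
def chebReduced (m : ℕ) (hm : 1 ≤ m) : ReducedPullback (cheb m) where
  B := { poly := chebV m * chebW m
         deg := 2 * m
         natDegree_le := natDegree_mul_le.trans
           (by linarith [natDegree_chebV_le m, natDegree_chebW_le m]) }
  k := 2 * m + 1
  one_le_k := by omega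
  c := 64
  c_ne_zero := by norm_num
  h := X ^ (2 * m) * (X - 1) ^ (2 * m) * (chebV m * chebW m) ^ (2 * m - 1)
  hdiv := by
    change ((Chebyshev.C ℤ (2 * m + 1)).comp chart + 2) * 4 * ((Chebyshev.C ℤ (2 * m + 1)).comp chart + 2 - 4)
        * (X ^ (2 * m) * (X - 1) ^ (2 * m) * (chebV m * chebW m) ^ (2 * m - 1)) =
      Polynomial.C 64 * ((X ^ 2 - X) * (chebV m * chebW m)) ^ (2 * m + 1)
    rw [cheb_num_sub_den_eq, cheb_num_eq]
    set V := chebV m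
    set W := chebW m
    have hC : (Polynomial.C (64 : ℤ) : ℤ[X]) = 64 := rfl
    obtain ⟨a, ha⟩ : ∃ a, 2 * m = a + 1 := ⟨2 * m - 1, by omega⟩
    have h1 : 2 * m - 1 = a := by omega
    have h2 : 2 * m + 1 = a + 2 := by omega
    rw [hC, h1, h2, ha, show (X ^ 2 - X : ℤ[X]) = X * (X - 1) by ring]
    simp only [mul_pow]
    ring
  hdeg := by
    change (X ^ (2 * m) * (X - 1) ^ (2 * m) * (chebV m * chebW m) ^ (2 * m - 1) : ℤ[X]).natDegree
        + 3 * (2 * m + 1) ≤ (2 * m + 1) * (3 + 2 * m)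
    have hVW : (chebV m * chebW m).natDegree ≤ 2 * m :=
      natDegree_mul_le.trans (by linarith [natDegree_chebV_le m, natDegree_chebW_le m])
    have hX1 : (X - 1 : ℤ[X]).natDegree ≤ 1 :=
      (natDegree_sub_le _ _).trans (by rw [natDegree_X, natDegree_one]; norm_num)
    have h1 : (X ^ (2 * m) * (X - 1) ^ (2 * m) : ℤ[X]).natDegree ≤ 2 * m + 2 * m :=
      natDegree_mul_le.trans (Nat.add_le_add (by rw [natDegree_X_pow])
        (natDegree_pow_le.trans (by simpa using Nat.mul_le_mul_left (2 * m) hX1)))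
    have h2 : ((chebV m * chebW m) ^ (2 * m - 1)).natDegree ≤ (2 * m - 1) * (2 * m) :=
      natDegree_pow_le.trans (Nat.mul_le_mul_left _ hVW)
    have h3 := natDegree_mul_le.trans (Nat.add_le_add h1 h2)
    have key : 2 * m + 2 * m + (2 * m - 1) * (2 * m) + 3 * (2 * m + 1) ≤ (2 * m + 1) * (3 + 2 * m) := by
      obtain ⟨k, rfl⟩ : ∃ k, m = k + 1 := ⟨m - 1, by omega⟩
      have e : 2 * (k + 1) - 1 = 2 * k + 1 := by omega
      rw [e]
      exact Nat.le_of_eq (by ring)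
    linarith
  j := 1
  hBdiv := by
    change (chebV m * chebW m) ∣ (((Chebyshev.C ℤ (2 * m + 1)).comp chart + 2) * 4 *
      ((Chebyshev.C ℤ (2 * m + 1)).comp chart + 2 - 4)) ^ 1
    rw [pow_one, cheb_num_sub_den_eq, cheb_num_eq]
    exact ⟨4 * X * chebV m * 4 * (4 * (X - 1)) * chebW m, by ring⟩
  ne_zero := by
    change (((Chebyshev.C ℤ (2 * m + 1)).comp chart + 2) * 4 *
      ((Chebyshev.C ℤ (2 * m + 1)).comp chart + 2 - 4) : ℤ[X]) ≠ 0
    have hodd : ((2 * (m : ℤ) + 1)).negOnePow = -1 := Int.negOnePow_odd _ ⟨m, by ring⟩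
    have hc1 : (chart).eval 1 = (2 : ℤ) := by simp [chart]
    have hc0 : (chart).eval 0 = (-2 : ℤ) := by simp [chart]
    have hnum : ((Chebyshev.C ℤ (2 * m + 1)).comp chart + 2).eval 1 = (4 : ℤ) := by
      rw [eval_add, eval_comp, hc1, C_eval_two, eval_ofNat]; norm_num
    have hsub : ((Chebyshev.C ℤ (2 * m + 1)).comp chart + 2 - 4).eval 0 = (-4 : ℤ) := by
      rw [eval_sub, eval_add, eval_comp, hc0, eval_ofNat, eval_ofNat]
      have h2 := C_eval_neg_two ℤ (2 * (m : ℤ) + 1)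
      rw [hodd] at h2
      rw [h2]; norm_num
    refine mul_ne_zero (mul_ne_zero ?_ (by norm_num)) ?_
    · intro h
      have := congrArg (Polynomial.eval 1) h
      rw [hnum, eval_zero] at this
      norm_num at this
    · intro h
      have := congrArg (Polynomial.eval 0) h
      rw [hsub, eval_zero] at this
      norm_num at this

/-- `deg B = 2m = p − 1`. [cite: MochizukiGenEll2010, Prop 1.7 p.9] -/
@[simp] theorem chebReduced_B_deg (m : ℕ) (hm : 1 ≤ m) : (chebReduced m hm).B.deg = 2 * m := rfl

/-- `γ_p` has degree EXACTLY `p = 2m + 1` as a polynomial map: `deg (C_p(4t−2) + 2) = 2m + 1`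
(`= 4t·V²` with `V` of degree `m`, leading coefficient `4^m`). [cite: MochizukiGenEll2010, Thm 2.1 p.13] -/
theorem natDegree_cheb_num (m : ℕ) : (cheb m).num.natDegree = 2 * m + 1 := by
  change ((Chebyshev.C ℤ (2 * m + 1)).comp chart + 2).natDegree = 2 * m + 1
  rw [cheb_num_eq]
  obtain ⟨hdS, hmS⟩ := natDegree_S_sub ℤ m
  have hchartC : chart = Polynomial.C 4 * X - Polynomial.C 2 := by
    simp only [chart, map_ofNat]
  have h42 : (Polynomial.C (2 : ℤ)).natDegree < (Polynomial.C (4 : ℤ) * X).natDegree := by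
    rw [natDegree_C, natDegree_C_mul_X 4 (by norm_num)]; exact Nat.zero_lt_one
  have hchart : (chart).natDegree = 1 := by
    rw [hchartC, natDegree_sub_eq_left_of_natDegree_lt h42, natDegree_C_mul_X 4 (by norm_num)]
  have hlc : (chart).leadingCoeff = 4 := by
    rw [hchartC, sub_eq_add_neg, ← map_neg Polynomial.C, leadingCoeff_add_of_degree_lt',
      leadingCoeff_C_mul_X]
    rw [degree_C (by norm_num : (-2 : ℤ) ≠ 0), degree_C_mul_X (by norm_num : (4 : ℤ) ≠ 0)]
    exact zero_lt_one
  have hV : (chebV m).natDegree = m := by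
    rw [chebV, natDegree_comp, hdS, hchart, mul_one]
  have hV0 : chebV m ≠ 0 := by
    intro h
    have hlcV : (chebV m).leadingCoeff = 4 ^ m := by
      rw [chebV, leadingCoeff_comp (by rw [hchart]; exact one_ne_zero), hmS.leadingCoeff, hlc, hdS,
        one_mul]
    rw [h, leadingCoeff_zero] at hlcV
    exact absurd hlcV.symm (pow_ne_zero _ (by norm_num))
  have h4X : (4 * X : ℤ[X]).natDegree = 1 := by
    rw [show (4 * X : ℤ[X]) = Polynomial.C 4 * X by simp only [map_ofNat]]
    exact natDegree_C_mul_X 4 (by norm_num)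
  have h4X0 : (4 * X : ℤ[X]) ≠ 0 := by
    intro h; rw [h, natDegree_zero] at h4X; exact absurd h4X (by norm_num)
  rw [natDegree_mul h4X0 (pow_ne_zero _ hV0), h4X, natDegree_pow, hV]
  ring

end P1FiniteMap

namespace NFPoint

/-- **TRANSFER ALONG THE CHEBYSHEV MAP `γ_p`**, `p = 2m+1 ≥ 3`: given the height lower bound
`p·ht(x) ≤ ht(γ_p(x)) + C_γ` (hypothesis `hlow` — Prop. 1.4 (i)/(iii) for this degree-`p` polynomial
map: the weighted root-height bound for the monic degree-`p` relation between `x` and `γ_p(x)`), Vojta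
with `ε ≥ 0` on `T` in degree `≤ d` and `2mε < 1` imply Vojta with `(1+ε)/(1 − 2mε) − 1` in degree `≤ d`
on the points whose `γ_p`-image (re-presented over its minimal field) lies in `T`.
[cite: MochizukiGenEll2010, Thm 2.1 p.13] -/
theorem vojtaIneq_transfer_cheb {m : ℕ} (hm : 1 ≤ m) {Cγ : ℝ}
    (hlow : ∀ P : NFPoint, P.OffDiv (P1FiniteMap.cheb m).pullbackCusps →
      ((P1FiniteMap.cheb m).deg : ℝ) * P.ht ≤
        (P.degree : ℝ)⁻¹ * logHeight₁ ((P1FiniteMap.cheb m).eval P.x) + Cγ)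
    {T : Set NFPoint} {d : ℕ} {ε : ℝ} (hε : 0 ≤ ε) (hεn : ε * (2 * m) < 1) (hV : VojtaIneq T d ε) :
    VojtaIneq ((P1FiniteMap.cheb m).preimageSet T) d ((1 + ε) / (1 - ε * (2 * m)) - 1) := by
  have hcast : (((P1FiniteMap.chebReduced m hm).B.deg : ℕ) : ℝ) = 2 * (m : ℝ) := by
    rw [P1FiniteMap.chebReduced_B_deg]; push_cast; ring
  have hdeg : ((P1FiniteMap.cheb m).deg : ℝ) = 2 * m + 1 := by
    change (((2 * m + 1 : ℕ)) : ℝ) = _; push_cast; ring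
  have ha : (1 + ε) * ((P1FiniteMap.chebReduced m hm).B.deg : ℝ) < (P1FiniteMap.cheb m).deg := by
    rw [hcast, hdeg]; nlinarith
  have h := vojtaIneq_transfer (P1FiniteMap.chebReduced m hm) hlow hε ha hV
  rw [hcast, hdeg] at h
  have he : (2 * (m : ℝ) + 1) - (1 + ε) * (2 * m) = 1 - ε * (2 * m) := by ring
  rwa [he] at h

end NFPoint

end Literature.NumberTheory.DiophantineGeometry.GenEll

end
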